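import Literature.NumberTheory.Automorphic.ArchLocalWallDescentFormula          -- ★ p840453 (d2): the fibre integral `fiberIntegralE_comp_conj_mk`; brings `circleDiagonal`, `archLocal`
import Literature.NumberTheory.Automorphic.ArchLocalSplitSingularCentralizer   -- ★ (V9) p837987: `Z(t_w z₀) = range ι`, `circleDiagonal_eq_endoEmb`, `exists_centralizer_continuousMulEquiv_of_splitSingular`
import Mathlib.MeasureTheory.Measure.Haar.Unique
import HarnessLib

/-!
# BLOCK UNFOLDING OF THE FIBRE INTEGRAL at a wall of the circle torus of `G_w = U(σ_w diag α)(ℂ)`: the `H_w`-orbital function of the conjugated test function is the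
# `U(e₀,e₂)`-torus orbital function of an explicit 2×2 test function (ROAD-Sd, in-house road to the letter (J-nc), step (d2′); Rogawski 1990 §8.2 p. 123, §4.8 Case (a))

Topic `NumberTheory/Automorphic`; namespaces `Literature.NumberTheory.Automorphic` (§1, generic) and `….UnitaryGroup` (§2).  THEOREMS ONLY (no `def`, no instance, no notation, no
axiom, no named fact, no `sorry`).  Cell `pub/hodgecm-mathlib`, ENGINE T1 (crux H413 = `stmt-HodgeConjecture-24833`); floor-1 preparation, count-neutral, under books rows #111 (S-d) ∕
#88 (ST-∞): PLAN v8 row «(J-nc) in-house road = DESCENT (d1)(d2)(d2′) + HAT-BOX (p07) + FILE M (p05) + interchange (d3)» (LEAD DESK WORDS T8-28 (1) ∕ T8-31 (1), F0P3a-plan (g9),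
2026-09-01); author F0P3a-p06 (g10); per place (desk ruling T6-84 (V7)).  THIS FILE = (d2′): the interface between the descent (★ p840453: `F_Θ(z) = ∫_{G_w⧸H_w}` of the
fibre integrals `gH_w ↦ ∫_{H_w} Θ(g·(h·t_w z·h⁻¹)·g⁻¹) dρ(h)`) and the RANK-ONE statements (HAT-BOX (HB), FILE M (M4): integrals `∫_{G₂} f ↑↑(h₂·diag(a,b)·h₂⁻¹) dμ₂` on a 2×2
unitary group).

SETTING.  Wall point `z₀ 0 = z₀ 2 ≠ z₀ 1`; `H_w = Z(t_w z₀)`; ★ (V9): `H_w = range ι` for the endoscopic block embedding `ι : G₂ × G₁ →* G_w`,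
`G₂ = U(σ_w diag(α₀,α₂))(ℂ)`, `G₁ = U(σ_w α₁)(ℂ)`, with a topological-group isomorphism `e : H_w ≃ₜ* G₂ × G₁`, `e⁻¹ = ι` (★ `exists_centralizer_continuousMulEquiv_of_splitSingular`),
and EVERY torus point is `t_w(z) = ι(diag(z₀,z₂), (z₁))` (★ `circleDiagonal_eq_endoEmb`); the matrix of `ι(g₂, g₁)` is `endoForm ↑↑g₂ ↑↑g₁` (the `(* 0 *; 0 * 0; * 0 *)` pattern, ★
`coe_endoGL`).

WHAT IS PROVED.
* §1 GENERIC: `integral_eq_haarScalarFactor_smul_integral_comp_symm` — for a closed subgroup `Z ≤ G` (second countable locally compact), `e : Z ≃ₜ* P`, Haar `ρ` on `Z` and Haar `μ` on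
  `P`: `∫_Z φ dρ = c • ∫_P φ(e⁻¹ p) dμ` with `c = haarScalarFactor ρ (μ.map e.symm) > 0` (Haar uniqueness, Mathlib `isMulLeftInvariant_eq_smul`; `ContinuousMulEquiv.isHaarMeasure_map`);
  `integral_prod_comp_fst` — `∫_{P₂×P₁} F(p.1) d(μ₂ × μ₁) = (μ₁ univ).toReal • ∫_{P₂} F dμ₂` (Mathlib `map_fst_prod`).
* §2 AT THE WALL: `fin_one_unitary_mul_comm` (the `U(e₁)` factor is commutative), **`endoEmb_mul_circleDiagonal_mul_inv`** — `ι(p)·t_w(z)·ι(p)⁻¹ = ι(p.1·diag(z₀,z₂)·p.1⁻¹, (z₁))`;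
  `coe_coe_endoEmb_eq_endoForm`; **`exists_fiberIntegral_comp_conj_wall_eq_smul_integral_block`** — for any Haar `ρ` on `H_w`, Haar `μ₂`, `μ₁`: ONE `c > 0` (the Haar scalar factor of
  `ρ` against `(μ₂×μ₁).map e⁻¹`) with, for every `g ∈ G_w`, every `z`, every continuous ambient `Θ : M_3(ℂ) → E`:
  `∫_{H_w} Θ ↑↑(g·(h·t_w z·h⁻¹)·g⁻¹) dρ(h) = (c · (μ₁ univ).toReal) • ∫_{G₂} Θ(↑↑g · endoForm ↑↑(h₂·diag(z₀,z₂)·h₂⁻¹) ↑↑(z₁) · ↑↑g⁻¹) dμ₂(h₂)`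
  — LHS = the fibre integrand of ★ p840453 `fiberIntegralE_comp_conj_mk` verbatim; RHS = the `G₂`-conjugation average of the EXPLICIT ambient 2×2 test function
  `f_g X := Θ(↑↑g · endoForm X ↑↑(z₁) · ↑↑g⁻¹)` (affine in `X`), in the token shape `∫ f ↑↑(h₂·diag(a,b)·h₂⁻¹) dμ₂` of the HAT-BOX ∕ FILE M heads ((HB) normalises the form to `diag(1,−1)`
  by its congruence rider).
NOT HERE: finiteness∕positivity bookkeeping of `μ₁ univ` (`G₁ ≅ S¹` compact — one line for the consumer via ★ p840191 with `N = 1`), the dominated interchange (d3), the rank-one formula itself.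
HONEST LABEL: HC_CM is proved only modulo the printed citations until rung 0 closes; this file is measure-theoretic bookkeeping and pays nothing by itself.

## References
* [Rogawski1990] J. D. Rogawski, *Automorphic Representations of Unitary Groups in Three Variables*, Ann. of Math. Stud. 123 (1990), §8.2 p. 123 (descent to `H`, `H′`; «can be written as
  integrals over `GL₂` or the multiplicative group of a quaternion algebra»), §4.8 Case (a) p. 53 (the block subgroup), §1.7 p. 6 (measures).
* [Folland1995] G. B. Folland, *A Course in Abstract Harmonic Analysis* (1995), §2.2 Thm. 2.20 (Haar uniqueness), §2.6.
* [DeitmarEchterhoff2014] A. Deitmar, S. Echterhoff, *Principles of Harmonic Analysis*, 2nd ed. (2014), Thm. 1.5.3.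
-/

set_option autoImplicit false

noncomputable section

open MeasureTheory Measure NumberField NumberField.InfinitePlace Filter Topology
open Literature.MeasureTheory.Group Literature.NumberTheory.Rogawski1990
open scoped MatrixGroups NNReal ENNReal

namespace Literature.NumberTheory.Automorphic

/-! ## §1 Generic: Haar transport along a topological-group isomorphism, and integrating out a factor -/

section Generic

variable {G : Type*} [Group G] [TopologicalSpace G] [IsTopologicalGroup G] [SecondCountableTopology G] [T2Space G]
  [MeasurableSpace G] [BorelSpace G]
  (Z : Subgroup G) (hZ : IsClosed (Z : Set G))
  {P : Type*} [Group P] [TopologicalSpace P] [IsTopologicalGroup P] [MeasurableSpace P] [BorelSpace P]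
  (e : Z ≃ₜ* P) (ρ : Measure Z) [ρ.IsHaarMeasure] (μ : Measure P) [μ.IsHaarMeasure]
  {E : Type*} [NormedAddCommGroup E] [NormedSpace ℝ E]

omit [T2Space G] in
include hZ in
/-- **HAAR TRANSPORT ALONG `e : Z ≃ₜ* P`**: `∫_Z φ dρ = c • ∫_P φ(e⁻¹ p) dμ`, `c = haarScalarFactor ρ (μ.map e⁻¹)` (two Haar measures on the second countable locally compact `Z`
differ by a positive scalar — Mathlib `isMulLeftInvariant_eq_smul`; `μ.map e⁻¹` is Haar — `ContinuousMulEquiv.isHaarMeasure_map`). [cite: Folland1995, §2.2 Thm. 2.20]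
[cite: DeitmarEchterhoff2014, Thm. 1.5.3] -/
theorem integral_eq_haarScalarFactor_smul_integral_comp_symm [LocallyCompactSpace G] (φ : Z → E) :
    ∫ h, φ h ∂ρ = (haarScalarFactor ρ (μ.map e.symm) : ℝ) • ∫ p, φ (e.symm p) ∂μ := by
  haveI : LocallyCompactSpace Z := hZ.locallyCompactSpace
  have hρ : ρ = haarScalarFactor ρ (μ.map e.symm) • μ.map e.symm := isMulLeftInvariant_eq_smul ρ (μ.map e.symm)
  have hmap : ∫ p, φ (e.symm p) ∂μ = ∫ h, φ h ∂(μ.map e.symm) := by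
    have h := integral_map_equiv (μ := μ) e.symm.toHomeomorph.toMeasurableEquiv φ
    rw [Homeomorph.toMeasurableEquiv_coe] at h
    exact h.symm
  rw [hmap]
  conv_lhs => rw [hρ]
  rw [integral_smul_nnreal_measure, NNReal.smul_def]

omit [SecondCountableTopology G] [T2Space G] in
/-- The transport constant is positive. [cite: Folland1995, §2.2 Thm. 2.20] -/
theorem haarScalarFactor_map_symm_pos : 0 < haarScalarFactor ρ (μ.map e.symm) :=
  haarScalarFactor_pos_of_isHaarMeasure ρ (μ.map e.symm)

omit [SecondCountableTopology G] [T2Space G] [BorelSpace G] [IsTopologicalGroup P] [BorelSpace P] in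
/-- **Integrating out a factor on which the integrand does not depend**: `∫_{P₂ × P₁} F(p.1) d(μ₂ × μ₁) = (μ₁ univ).toReal • ∫_{P₂} F dμ₂` (Mathlib `map_fst_prod`; with the
usual convention `∞.toReal = 0`). [cite: Folland1995, §2.6] -/
theorem integral_prod_comp_fst {P₂ P₁ : Type*} [MeasurableSpace P₂] [MeasurableSpace P₁] (μ₂ : Measure P₂) (μ₁ : Measure P₁) [SFinite μ₁] [SFinite μ₂]
    (F : P₂ → E) (hF : AEStronglyMeasurable F μ₂) :
    ∫ p : P₂ × P₁, F p.1 ∂(μ₂.prod μ₁) = (μ₁ Set.univ).toReal • ∫ x, F x ∂μ₂ := by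
  have hF' : AEStronglyMeasurable F ((μ₂.prod μ₁).map Prod.fst) := by
    rw [Measure.map_fst_prod]; exact hF.smul_measure _
  rw [← integral_map measurable_fst.aemeasurable hF', Measure.map_fst_prod, integral_smul_measure]

end Generic

/-! ## §2 At a wall: the `H_w`-orbital function is the `G₂`-torus orbital function of an explicit 2×2 test function -/

namespace UnitaryGroup

section Wall

variable (L : Type) [Field L] (α : Fin 3 → L) (w : {w : InfinitePlace L // IsComplex w})

/-- The `U(σ_w α₁)(ℂ)` factor (1×1 matrices) is COMMUTATIVE. [cite: Rogawski1990, §4.8 Case (a) p. 53] -/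
theorem fin_one_unitary_mul_comm (u v : unitaryGroupOfForm (starRingEnd ℂ) ((Matrix.diagonal ![α 1]).map w.1.embedding)) : u * v = v * u := by
  apply Subtype.ext; apply Units.ext
  rw [Subgroup.coe_mul, Subgroup.coe_mul, Units.val_mul, Units.val_mul]
  ext i j
  fin_cases i; fin_cases j
  simp [Matrix.mul_apply, mul_comm]

/-- **`ι(p) · t_w(z) · ι(p)⁻¹ = ι(p.1 · diag(z₀,z₂) · p.1⁻¹, (z₁))`**: conjugating a torus point by the block group moves only the 2×2 block (★ `circleDiagonal_eq_endoEmb`, `ι` a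
homomorphism, the 1×1 factor commutative). [cite: Rogawski1990, §8.2 p. 123; §4.8 Case (a) p. 53] -/
theorem endoEmb_mul_circleDiagonal_mul_inv
    (p : unitaryGroupOfForm (starRingEnd ℂ) ((Matrix.diagonal ![α 0, α 2]).map w.1.embedding) × unitaryGroupOfForm (starRingEnd ℂ) ((Matrix.diagonal ![α 1]).map w.1.embedding))
    (z : Fin 3 → Circle) :
    (endoEmb (starRingEnd ℂ) ((Matrix.diagonal ![α 0, α 2]).map w.1.embedding) ((Matrix.diagonal ![α 1]).map w.1.embedding)
          ((Matrix.diagonal α).map w.1.embedding) (endoForm_archLocal_diagonal L α w)) p *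
        (⟨circleDiagonal 3 z, circleDiagonal_mem_archLocal_diagonal L 3 α w z⟩ : unitaryGroupOfForm (starRingEnd ℂ) ((Matrix.diagonal α).map w.1.embedding)) *
        ((endoEmb (starRingEnd ℂ) ((Matrix.diagonal ![α 0, α 2]).map w.1.embedding) ((Matrix.diagonal ![α 1]).map w.1.embedding)
          ((Matrix.diagonal α).map w.1.embedding) (endoForm_archLocal_diagonal L α w)) p)⁻¹ =
      (endoEmb (starRingEnd ℂ) ((Matrix.diagonal ![α 0, α 2]).map w.1.embedding) ((Matrix.diagonal ![α 1]).map w.1.embedding)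
          ((Matrix.diagonal α).map w.1.embedding) (endoForm_archLocal_diagonal L α w))
        (p.1 * ⟨circleDiagonal 2 ![z 0, z 2], (circleDiagonal_blocks_mem L α w z).1⟩ * p.1⁻¹, ⟨circleDiagonal 1 ![z 1], (circleDiagonal_blocks_mem L α w z).2⟩) := by
  rw [circleDiagonal_eq_endoEmb L α w z, ← map_mul, ← map_inv, ← map_mul]
  congr 1
  ext1
  · rfl
  · show p.2 * ⟨circleDiagonal 1 ![z 1], (circleDiagonal_blocks_mem L α w z).2⟩ * p.2⁻¹ = ⟨circleDiagonal 1 ![z 1], (circleDiagonal_blocks_mem L α w z).2⟩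
    rw [fin_one_unitary_mul_comm L α w p.2, mul_assoc, mul_inv_cancel, mul_one]

/-- The matrix of `ι(g₂, g₁)` is the block pattern `endoForm ↑↑g₂ ↑↑g₁` (★ `coe_endoGL`, `endoForm` — the same `reindex endoPerm endoPerm (fromBlocks · 0 0 ·)`).
[cite: Rogawski1990, §4.8 Case (a) p. 53] -/
theorem coe_coe_endoEmb_eq_endoForm
    (p : unitaryGroupOfForm (starRingEnd ℂ) ((Matrix.diagonal ![α 0, α 2]).map w.1.embedding) × unitaryGroupOfForm (starRingEnd ℂ) ((Matrix.diagonal ![α 1]).map w.1.embedding)) :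
    ((((endoEmb (starRingEnd ℂ) ((Matrix.diagonal ![α 0, α 2]).map w.1.embedding) ((Matrix.diagonal ![α 1]).map w.1.embedding)
          ((Matrix.diagonal α).map w.1.embedding) (endoForm_archLocal_diagonal L α w)) p : unitaryGroupOfForm (starRingEnd ℂ) ((Matrix.diagonal α).map w.1.embedding)) :
        GL (Fin 3) ℂ) : Matrix (Fin 3) (Fin 3) ℂ) =
      endoForm (((p.1 : GL (Fin 2) ℂ)) : Matrix (Fin 2) (Fin 2) ℂ) (((p.2 : GL (Fin 1) ℂ)) : Matrix (Fin 1) (Fin 1) ℂ) := by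
  rw [coe_endoEmb, coe_endoGL]
  rfl

variable [MeasurableSpace (archLocal L 3 (Matrix.diagonal α) w)] [BorelSpace (archLocal L 3 (Matrix.diagonal α) w)]
  [MeasurableSpace (unitaryGroupOfForm (starRingEnd ℂ) ((Matrix.diagonal ![α 0, α 2]).map w.1.embedding))]
  [BorelSpace (unitaryGroupOfForm (starRingEnd ℂ) ((Matrix.diagonal ![α 0, α 2]).map w.1.embedding))]
  [MeasurableSpace (unitaryGroupOfForm (starRingEnd ℂ) ((Matrix.diagonal ![α 1]).map w.1.embedding))]
  [BorelSpace (unitaryGroupOfForm (starRingEnd ℂ) ((Matrix.diagonal ![α 1]).map w.1.embedding))]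

/-- **BLOCK UNFOLDING OF THE FIBRE INTEGRAL AT A WALL**: for a wall point `z₀` (`z₀ 0 = z₀ 2 ≠ z₀ 1`), `e : Z(t_w z₀) ≃ₜ* G₂ × G₁` with `e⁻¹ = ι` (★ (V9)), ANY Haar measure `ρ`
on `Z(t_w z₀)`, Haar measures `μ₂` on `G₂ = U(σ_w diag(α₀,α₂))(ℂ)` and `μ₁` on `G₁ = U(σ_w α₁)(ℂ)`: there is ONE constant `c > 0` (the Haar scalar factor of `ρ` against `(μ₂ × μ₁).map e⁻¹`)
such that for every `g ∈ G_w`, every torus parameter `z` and every continuous ambient `Θ`: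
`∫_{Z(t_w z₀)} Θ ↑↑(g·(h·t_w z·h⁻¹)·g⁻¹) dρ(h) = (c · (μ₁ univ).toReal) • ∫_{G₂} Θ(↑↑g · endoForm ↑↑(h₂·diag(z₀,z₂)·h₂⁻¹) ↑↑(z₁) · ↑↑g⁻¹) dμ₂(h₂)`
— the `H_w`-orbital function of the conjugated test function (★ p840453 `fiberIntegralE_comp_conj_mk`) IS the `G₂`-torus orbital function of the explicit 2×2 test function
`X ↦ Θ(↑↑g · endoForm X ↑↑(z₁) · ↑↑g⁻¹)`, the socket of the rank-one statements (HAT-BOX ∕ FILE M). [cite: Rogawski1990, §8.2 p. 123; §4.8 Case (a) p. 53]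
[cite: Folland1995, §2.2 Thm. 2.20; §2.6] -/
theorem exists_fiberIntegral_comp_conj_wall_eq_smul_integral_block
    [SecondCountableTopology (archLocal L 3 (Matrix.diagonal α) w)] [LocallyCompactSpace (archLocal L 3 (Matrix.diagonal α) w)]
    [SecondCountableTopology (unitaryGroupOfForm (starRingEnd ℂ) ((Matrix.diagonal ![α 0, α 2]).map w.1.embedding))]
    [LocallyCompactSpace (unitaryGroupOfForm (starRingEnd ℂ) ((Matrix.diagonal ![α 0, α 2]).map w.1.embedding))]
    [SecondCountableTopology (unitaryGroupOfForm (starRingEnd ℂ) ((Matrix.diagonal ![α 1]).map w.1.embedding))]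
    [LocallyCompactSpace (unitaryGroupOfForm (starRingEnd ℂ) ((Matrix.diagonal ![α 1]).map w.1.embedding))]
    {z₀ : Fin 3 → Circle}
    (e : Subgroup.centralizer ({(⟨circleDiagonal 3 z₀, circleDiagonal_mem_archLocal_diagonal L 3 α w z₀⟩ : archLocal L 3 (Matrix.diagonal α) w)} :
        Set (archLocal L 3 (Matrix.diagonal α) w)) ≃ₜ*
      (unitaryGroupOfForm (starRingEnd ℂ) ((Matrix.diagonal ![α 0, α 2]).map w.1.embedding) × unitaryGroupOfForm (starRingEnd ℂ) ((Matrix.diagonal ![α 1]).map w.1.embedding)))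
    (he : ∀ p, ((e.symm p : Subgroup.centralizer ({(⟨circleDiagonal 3 z₀, circleDiagonal_mem_archLocal_diagonal L 3 α w z₀⟩ : archLocal L 3 (Matrix.diagonal α) w)} :
        Set (archLocal L 3 (Matrix.diagonal α) w))) : archLocal L 3 (Matrix.diagonal α) w) =
      (endoEmb (starRingEnd ℂ) ((Matrix.diagonal ![α 0, α 2]).map w.1.embedding) ((Matrix.diagonal ![α 1]).map w.1.embedding)
        ((Matrix.diagonal α).map w.1.embedding) (endoForm_archLocal_diagonal L α w)) p)
    (ρ : Measure (Subgroup.centralizer ({(⟨circleDiagonal 3 z₀, circleDiagonal_mem_archLocal_diagonal L 3 α w z₀⟩ : archLocal L 3 (Matrix.diagonal α) w)} :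
        Set (archLocal L 3 (Matrix.diagonal α) w)))) [ρ.IsHaarMeasure]
    (μ₂ : Measure (unitaryGroupOfForm (starRingEnd ℂ) ((Matrix.diagonal ![α 0, α 2]).map w.1.embedding))) [μ₂.IsHaarMeasure]
    (μ₁ : Measure (unitaryGroupOfForm (starRingEnd ℂ) ((Matrix.diagonal ![α 1]).map w.1.embedding))) [μ₁.IsHaarMeasure] :
    ∃ c : ℝ, 0 < c ∧ ∀ (g : archLocal L 3 (Matrix.diagonal α) w) (z : Fin 3 → Circle) {E : Type} [NormedAddCommGroup E] [NormedSpace ℝ E]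
      (Θ : Matrix (Fin 3) (Fin 3) ℂ → E), Continuous Θ →
      ∫ h : Subgroup.centralizer ({(⟨circleDiagonal 3 z₀, circleDiagonal_mem_archLocal_diagonal L 3 α w z₀⟩ : archLocal L 3 (Matrix.diagonal α) w)} :
            Set (archLocal L 3 (Matrix.diagonal α) w)),
          Θ ((((g * ((h : archLocal L 3 (Matrix.diagonal α) w) * ⟨circleDiagonal 3 z, circleDiagonal_mem_archLocal_diagonal L 3 α w z⟩ *
            (h : archLocal L 3 (Matrix.diagonal α) w)⁻¹) * g⁻¹ : archLocal L 3 (Matrix.diagonal α) w) : GL (Fin 3) ℂ) : Matrix (Fin 3) (Fin 3) ℂ)) ∂ρ =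
        (c * (μ₁ Set.univ).toReal) •
          ∫ h₂ : unitaryGroupOfForm (starRingEnd ℂ) ((Matrix.diagonal ![α 0, α 2]).map w.1.embedding),
            Θ (((g : GL (Fin 3) ℂ) : Matrix (Fin 3) (Fin 3) ℂ) *
              endoForm ((((h₂ * ⟨circleDiagonal 2 ![z 0, z 2], (circleDiagonal_blocks_mem L α w z).1⟩ * h₂⁻¹ :
                  unitaryGroupOfForm (starRingEnd ℂ) ((Matrix.diagonal ![α 0, α 2]).map w.1.embedding)) : GL (Fin 2) ℂ) : Matrix (Fin 2) (Fin 2) ℂ))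
                ((((⟨circleDiagonal 1 ![z 1], (circleDiagonal_blocks_mem L α w z).2⟩ :
                  unitaryGroupOfForm (starRingEnd ℂ) ((Matrix.diagonal ![α 1]).map w.1.embedding)) : GL (Fin 1) ℂ) : Matrix (Fin 1) (Fin 1) ℂ)) *
              ((((g : GL (Fin 3) ℂ))⁻¹ : GL (Fin 3) ℂ) : Matrix (Fin 3) (Fin 3) ℂ)) ∂μ₂ := by
  haveI : ((μ₂.prod μ₁).map e.symm).IsHaarMeasure := ContinuousMulEquiv.isHaarMeasure_map (μ₂.prod μ₁) e.symm
  refine ⟨(haarScalarFactor ρ ((μ₂.prod μ₁).map e.symm) : ℝ),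
    NNReal.coe_pos.mpr (haarScalarFactor_map_symm_pos _ e ρ (μ₂.prod μ₁)), fun g z E _ _ Θ hΘ => ?_⟩
  -- names for the two integrands
  obtain ⟨φ, hφ⟩ : ∃ φ : Subgroup.centralizer ({(⟨circleDiagonal 3 z₀, circleDiagonal_mem_archLocal_diagonal L 3 α w z₀⟩ : archLocal L 3 (Matrix.diagonal α) w)} :
      Set (archLocal L 3 (Matrix.diagonal α) w)) → E, φ = fun h : Subgroup.centralizer
        ({(⟨circleDiagonal 3 z₀, circleDiagonal_mem_archLocal_diagonal L 3 α w z₀⟩ : archLocal L 3 (Matrix.diagonal α) w)} : Set (archLocal L 3 (Matrix.diagonal α) w)) =>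
        Θ ((((g * ((h : archLocal L 3 (Matrix.diagonal α) w) * ⟨circleDiagonal 3 z, circleDiagonal_mem_archLocal_diagonal L 3 α w z⟩ *
          (h : archLocal L 3 (Matrix.diagonal α) w)⁻¹) * g⁻¹ : archLocal L 3 (Matrix.diagonal α) w) : GL (Fin 3) ℂ) : Matrix (Fin 3) (Fin 3) ℂ)) := ⟨_, rfl⟩
  obtain ⟨F₂, hF₂⟩ : ∃ F₂ : unitaryGroupOfForm (starRingEnd ℂ) ((Matrix.diagonal ![α 0, α 2]).map w.1.embedding) → E, F₂ =
      fun h₂ : unitaryGroupOfForm (starRingEnd ℂ) ((Matrix.diagonal ![α 0, α 2]).map w.1.embedding) =>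
      Θ (((g : GL (Fin 3) ℂ) : Matrix (Fin 3) (Fin 3) ℂ) *
        endoForm ((((h₂ * ⟨circleDiagonal 2 ![z 0, z 2], (circleDiagonal_blocks_mem L α w z).1⟩ * h₂⁻¹ :
            unitaryGroupOfForm (starRingEnd ℂ) ((Matrix.diagonal ![α 0, α 2]).map w.1.embedding)) : GL (Fin 2) ℂ) : Matrix (Fin 2) (Fin 2) ℂ))
          ((((⟨circleDiagonal 1 ![z 1], (circleDiagonal_blocks_mem L α w z).2⟩ :
            unitaryGroupOfForm (starRingEnd ℂ) ((Matrix.diagonal ![α 1]).map w.1.embedding)) : GL (Fin 1) ℂ) : Matrix (Fin 1) (Fin 1) ℂ)) *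
        ((((g : GL (Fin 3) ℂ))⁻¹ : GL (Fin 3) ℂ) : Matrix (Fin 3) (Fin 3) ℂ)) := ⟨_, rfl⟩
  -- (2) the `Z`-integrand at `e⁻¹ p = ι p` depends on `p.1` only and is `F₂ p.1`
  have hint : ∀ p, φ (e.symm p) = F₂ p.1 := fun p => by
    rw [hφ, hF₂]
    dsimp only
    rw [he p]
    -- `archLocal` is a `def` over `unitaryGroupOfForm`: the block identity is used up to that unfolding
    erw [endoEmb_mul_circleDiagonal_mul_inv L α w p z]
    rw [Subgroup.coe_mul, Subgroup.coe_mul, Subgroup.coe_inv, Units.val_mul, Units.val_mul, coe_coe_endoEmb_eq_endoForm]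
  -- (3) `F₂` is continuous
  have hblock : Continuous fun X : Matrix (Fin 2) (Fin 2) ℂ => endoForm X
      ((((⟨circleDiagonal 1 ![z 1], (circleDiagonal_blocks_mem L α w z).2⟩ :
        unitaryGroupOfForm (starRingEnd ℂ) ((Matrix.diagonal ![α 1]).map w.1.embedding)) : GL (Fin 1) ℂ) : Matrix (Fin 1) (Fin 1) ℂ)) := by
    unfold endoForm
    simp only [Matrix.reindex_apply]
    exact (continuous_id.matrix_fromBlocks continuous_const continuous_const continuous_const).matrix_submatrix _ _
  have hd : Continuous fun h₂ : unitaryGroupOfForm (starRingEnd ℂ) ((Matrix.diagonal ![α 0, α 2]).map w.1.embedding) =>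
      ((((h₂ * ⟨circleDiagonal 2 ![z 0, z 2], (circleDiagonal_blocks_mem L α w z).1⟩ * h₂⁻¹ :
        unitaryGroupOfForm (starRingEnd ℂ) ((Matrix.diagonal ![α 0, α 2]).map w.1.embedding)) : GL (Fin 2) ℂ) : Matrix (Fin 2) (Fin 2) ℂ)) :=
    (Units.continuous_val.comp continuous_subtype_val).comp ((continuous_id.mul continuous_const).mul continuous_id.inv)
  have hF₂c : Continuous F₂ := by
    rw [hF₂]
    exact hΘ.comp ((continuous_const.matrix_mul (hblock.comp hd)).matrix_mul continuous_const)
  -- (1)+(2)+(3): Haar transport along `e`, then integrate out the `G₁` factor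
  have key : ∫ h, φ h ∂ρ = ((haarScalarFactor ρ ((μ₂.prod μ₁).map e.symm) : ℝ) * (μ₁ Set.univ).toReal) • ∫ x, F₂ x ∂μ₂ := by
    rw [integral_eq_haarScalarFactor_smul_integral_comp_symm _ (isClosed_coe_centralizer_singleton _) e ρ (μ₂.prod μ₁) φ, mul_smul]
    congr 1
    simp_rw [hint]
    exact integral_prod_comp_fst μ₂ μ₁ F₂ hF₂c.aestronglyMeasurable
  rw [hφ, hF₂] at key
  exact key

end Wall

end UnitaryGroup

end Literature.NumberTheory.Automorphic

end
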